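import Mathlib.Analysis.SpecialFunctions.Gaussian.PoissonSummation
import Mathlib.NumberTheory.ModularForms.JacobiTheta.TwoVariable
import Mathlib.Analysis.Normed.Ring.InfiniteSum
import HarnessLib

/-!
# Poisson summation for binary Gaussians with shift and twist
# (the theta transformation formula of a positive-definite binary quadratic form)

Topic `NumberTheory/Automorphic`, namespace `Literature.NumberTheory.Automorphic`. Theorem-only file
(no definition, no named fact): everything here is PROVED from Mathlib's one-variable Poisson
summation for Gaussians (`Complex.tsum_exp_neg_quadratic`).

Let `Q(x₁, x₂) = αx₁² + βx₁x₂ + γx₂²` be a positive-definite binary quadratic form with REAL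
coefficients (`α > 0`, `Δ := 4αγ − β² > 0`) and let `Q̃(ξ₁, ξ₂) = γξ₁² − βξ₁ξ₂ + αξ₂²` (so that
`Q̃/Δ` is the form of the inverse matrix: `Q(x) = ½xᵀAx`, `A = (2α β; β 2γ)`, `det A = Δ`,
`½ξᵀA⁻¹ξ = Q̃(ξ)/Δ`). The Fourier transform of `f(x) = e^{−2πQ(x)}` on `ℝ²` is
`f̂(ξ) = Δ^{−1/2}e^{−2πQ̃(ξ)/Δ}`, and Poisson summation over `ℤ²` with a shift `v ∈ ℝ²` and an
additive twist `w ∈ ℝ²` reads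

  `Σ_{(m,n)∈ℤ²} e^{−2πQ(m+v₁, n+v₂)} e(w₁m + w₂n)
      = Δ^{−1/2} Σ_{(k,l)∈ℤ²} e((k−w₁)v₁ + (l−w₂)v₂) e^{−2πQ̃(k−w₁, l−w₂)/Δ}`            (★)

(`e(x) = exp(2πix)`). This is the engine of the transformation law of the theta series of binary
quadratic forms, in particular of the congruent theta series
`Σ_{(m,n)≡(μ,ν) (c)} e^{−2πyQ(m,n)}` of an integral form `Q = am² + bmn + cn²`, `D = b² − 4ac < 0`,
whose dual side is the Gauss-sum-ready series
`(c²y√|D|)⁻¹ Σ_{(k,l)} e((kμ+lν)/c) e^{−2πQ̃(k,l)/(c²y|D|)}` (`tsum_exp_neg_congr_binaryQF`).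

Contents:
* `tsum_cexp_neg_sq_shift_twist` — the one-variable formula with shift AND twist,
  `Σ_m e^{−πa(m+v)²}e(wm) = a^{−1/2}Σ_k e((k−w)v)e^{−π(k−w)²/a}` (`a > 0`), a repackaging of
  Mathlib's `Complex.tsum_exp_neg_quadratic` (complex linear coefficient `b = iw − av`);
* `summable_exp_neg_mul_sq_add_int`, `summable_exp_neg_binaryQF` — summability of shifted
  one- and two-variable Gaussians over `ℤ`, `ℤ × ℤ` (domination `Q(x) ≥ (Δ/8γ)x₁² + (Δ/8α)x₂²`
  from the two completions of the square `4γQ − Δx₁² = (βx₁+2γx₂)²`, `4αQ − Δx₂² = (2αx₁+βx₂)²`);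
* `tsum_cexp_neg_binaryQF_shift_twist` — (★), by completing the square in the second variable,
  the one-variable formula twice, and Fubini on `ℤ × ℤ`;
* `tsum_exp_neg_congr_binaryQF` — the congruence-class corollary for integral forms (real Gaussians,
  additive character `𝐞 = Real.fourierChar`).

Design: the statements are over `ℤ × ℤ` (`tsum`), exponents written with `Complex.exp` of an
explicit complex number (the form most convenient to rewrite into); the corollary is written with
real Gaussians and the additive character `𝐞 = Real.fourierChar`. No modular-form language is used
or needed. Written for the cell `landau-siegel/ls-inputs` (line `theta-voronoi`, the planned
sub-stub V1a "2-dim Poisson for the congruent binary theta series" of the transformation law of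
the class-group theta series `θ(z;ψ)`, Conrey–Iwaniec 2002 §§2–3), but generic.

## References

* [Gunning1962] R. C. Gunning, *Lectures on Modular Forms*, Ann. of Math. Studies 48, Princeton
  (1962), Ch. V "Quadratic forms": §19 (convergence, `|θ_A| ≤ (Σ_n e^{−πcyn²})^r`), §20
  "The Generalized Jacobi Inversion Formula" (`θ_A(z;X) = ((−iz)^r det A)^{−1/2} Σ_M
  e^{−πiA^{−1}[M]/z + 2πiX·M}` by Poisson summation and completing the square), §22 Lemma 4
  (congruence decomposition of `θ(ζ + a/c; X/q)`) [held: lit `book:gunning1962-lectures-modular-forms`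
  p0044–p0049]. The additive twist `w` is not printed there; it is the same Poisson summation
  applied to `f(T)e(w·T)` and costs nothing in the proof.
-/

noncomputable section

open scoped Real FourierTransform
open Complex

namespace Literature.NumberTheory.Automorphic

/-! ## One variable: shift and twist -/

/-- `(a : ℂ) ^ (1/2) = √a` for `a ≥ 0` (plumbing). [folklore] -/
private theorem ofReal_cpow_half_eq_sqrt {a : ℝ} (ha : 0 ≤ a) :
    ((a : ℂ) ^ (1 / 2 : ℂ)) = (Real.sqrt a : ℂ) := by
  rw [Real.sqrt_eq_rpow, Complex.ofReal_cpow ha]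
  norm_num

/-- **Poisson summation for a shifted and twisted Gaussian** (one variable): for `a > 0` and real
`v, w`, `Σ_{m∈ℤ} e^{−πa(m+v)²} e(wm) = a^{−1/2} Σ_{k∈ℤ} e((k−w)v) e^{−π(k−w)²/a}`, written with
complex exponentials: the case `r = 1` of the generalized Jacobi inversion formula
`θ_A(z;X) = ((−iz)^r det A)^{−1/2} Σ_M e^{−πiA^{−1}[M]/z + 2πiX·M}` at `z = ia⁻¹·(…)`, with an extra
additive twist (Poisson summation applied to `t ↦ e^{−πa(t+v)²}e(wt)`). (Mathlib's
`Complex.tsum_exp_neg_quadratic` with the complex linear coefficient `b = iw − av`.)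
[cite: Gunning1962, §20 Generalized Jacobi Inversion Formula] -/
theorem tsum_cexp_neg_sq_shift_twist {a : ℝ} (ha : 0 < a) (v w : ℝ) :
    ∑' m : ℤ, cexp (-(π * a) * ((m : ℂ) + v) ^ 2 + 2 * π * I * w * m) =
      (Real.sqrt a : ℂ)⁻¹ *
        ∑' k : ℤ, cexp (2 * π * I * v * ((k : ℂ) - w) - π / a * ((k : ℂ) - w) ^ 2) := by
  have ha' : 0 < ((a : ℝ) : ℂ).re := by simp [ha]
  have hane : ((a : ℝ) : ℂ) ≠ 0 := Complex.ofReal_ne_zero.mpr ha.ne'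
  have h := Complex.tsum_exp_neg_quadratic ha' (I * w - a * v)
  have e1 : ∀ m : ℤ, cexp (-(π * a) * ((m : ℂ) + v) ^ 2 + 2 * π * I * w * m) =
      cexp (-(π * a * v ^ 2)) * cexp (-π * (a : ℂ) * m ^ 2 + 2 * π * (I * w - a * v) * m) := by
    intro m
    rw [← Complex.exp_add]
    congr 1
    ring
  have e2 : ∀ k : ℤ, cexp (-(π * a * v ^ 2)) * cexp (-π / (a : ℂ) * (k + I * (I * w - a * v)) ^ 2) =
      cexp (2 * π * I * v * ((k : ℂ) - w) - π / a * ((k : ℂ) - w) ^ 2) := by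
    intro k
    rw [← Complex.exp_add]
    congr 1
    linear_combination (norm := skip)
      (-(π : ℂ) * a * v ^ 2 - π / a * (2 * w * ((k : ℂ) - w - I * a * v) + (I ^ 2 + 1) * w ^ 2)) * I_sq
    field_simp
    ring
  simp_rw [e1]
  rw [tsum_mul_left, h, ofReal_cpow_half_eq_sqrt ha.le, one_div, ← mul_assoc, mul_comm (cexp _),
    mul_assoc, ← tsum_mul_left]
  congr 1
  exact tsum_congr e2

/-! ## Summability of shifted Gaussians over `ℤ` and `ℤ × ℤ` -/

/-- Summability of a shifted Gaussian over `ℤ`: `Σ_m e^{−c(m+v)²} < ∞` for `c > 0` (the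
one-variable majorant `Σ_n e^{−πcyn²}` in the convergence proof of theta series).
[cite: Gunning1962, §19 (convergence of theta series)] -/
theorem summable_exp_neg_mul_sq_add_int {c : ℝ} (hc : 0 < c) (v : ℝ) :
    Summable fun m : ℤ ↦ Real.exp (-c * ((m : ℝ) + v) ^ 2) := by
  -- compare with the Jacobi theta term at `z = i c v/π`, `τ = i c/π`
  have hτ : 0 < (I * (c / π : ℝ)).im := by
    rw [mul_comm, Complex.im_ofReal_mul, I_im, mul_one]; positivity
  have hs := (summable_jacobiTheta₂_term_iff (I * (c * v / π : ℝ)) (I * (c / π : ℝ))).mpr hτ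
  have hs' := hs.norm.mul_left (Real.exp (-c * v ^ 2))
  refine hs'.congr fun m ↦ ?_
  rw [norm_jacobiTheta₂_term]
  simp only [mul_comm I, Complex.im_ofReal_mul, I_im, mul_one]
  rw [← Real.exp_add]
  congr 1
  field_simp
  ring

/-- **Summability of a shifted binary Gaussian over `ℤ × ℤ`**: for `α > 0`, `4αγ − β² > 0` and
real shifts, `Σ_{(m,n)} e^{−(α(m+v₁)² + β(m+v₁)(n+v₂) + γ(n+v₂)²)} < ∞`. Domination by a
product: `4γQ(x) − Δx₁² = (βx₁ + 2γx₂)² ≥ 0` and `4αQ(x) − Δx₂² = (2αx₁ + βx₂)² ≥ 0` give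
`Q(x) ≥ (Δ/8γ)x₁² + (Δ/8α)x₂²` — the source's `|θ_A(z)| ≤ Σ_N e^{−πcy(n₁²+⋯+n_r²)} ≤ (Σ_n e^{−πcyn²})^r`.
[cite: Gunning1962, §19 (convergence of theta series)] -/
theorem summable_exp_neg_binaryQF {α β γ : ℝ} (hα : 0 < α) (hΔ : 0 < 4 * α * γ - β ^ 2)
    (v₁ v₂ : ℝ) :
    Summable fun p : ℤ × ℤ ↦
      Real.exp (-(α * ((p.1 : ℝ) + v₁) ^ 2 + β * ((p.1 : ℝ) + v₁) * ((p.2 : ℝ) + v₂) +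
        γ * ((p.2 : ℝ) + v₂) ^ 2)) := by
  have hγ : 0 < γ := by nlinarith [sq_nonneg β]
  set Δ : ℝ := 4 * α * γ - β ^ 2 with hΔdef
  have h1 := summable_exp_neg_mul_sq_add_int (c := Δ / (8 * γ)) (by positivity) v₁
  have h2 := summable_exp_neg_mul_sq_add_int (c := Δ / (8 * α)) (by positivity) v₂
  refine (h1.mul_of_nonneg h2 (fun _ ↦ (Real.exp_pos _).le) (fun _ ↦ (Real.exp_pos _).le)).of_nonneg_of_le
    (fun _ ↦ (Real.exp_pos _).le) fun p ↦ ?_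
  rw [← Real.exp_add, Real.exp_le_exp]
  set x : ℝ := (p.1 : ℝ) + v₁
  set y : ℝ := (p.2 : ℝ) + v₂
  -- `Q(x,y) ≥ (Δ/8γ)x² + (Δ/8α)y²`
  have hQ1 : Δ * x ^ 2 ≤ 4 * γ * (α * x ^ 2 + β * x * y + γ * y ^ 2) := by
    nlinarith [sq_nonneg (β * x + 2 * γ * y)]
  have hQ2 : Δ * y ^ 2 ≤ 4 * α * (α * x ^ 2 + β * x * y + γ * y ^ 2) := by
    nlinarith [sq_nonneg (2 * α * x + β * y)]
  have e1 : Δ / (8 * γ) * x ^ 2 = (Δ * x ^ 2) / (8 * γ) := by ring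
  have e2 : Δ / (8 * α) * y ^ 2 = (Δ * y ^ 2) / (8 * α) := by ring
  have i1 : (Δ * x ^ 2) / (8 * γ) ≤ (α * x ^ 2 + β * x * y + γ * y ^ 2) / 2 := by
    rw [div_le_div_iff₀ (by positivity) two_pos]; nlinarith
  have i2 : (Δ * y ^ 2) / (8 * α) ≤ (α * x ^ 2 + β * x * y + γ * y ^ 2) / 2 := by
    rw [div_le_div_iff₀ (by positivity) two_pos]; nlinarith
  rw [neg_mul, neg_mul, e1, e2]
  linarith


/-- `‖exp(R + iS)‖ = e^R` for real `R, S` (plumbing). [folklore] -/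
private theorem norm_cexp_ofReal_add_mul_I (R S : ℝ) : ‖cexp ((R : ℂ) + (S : ℂ) * I)‖ = Real.exp R := by
  rw [Complex.norm_exp]
  congr 1
  simp

/-! ## Two variables: the theta transformation formula -/

/-- **Poisson summation for a binary Gaussian with shift and twist** (the theta transformation
formula of a positive-definite binary quadratic form): for real `α > 0`, `Δ = 4αγ − β² > 0`,
`Q(x) = αx₁² + βx₁x₂ + γx₂²`, `Q̃(ξ) = γξ₁² − βξ₁ξ₂ + αξ₂²`, and real `v₁ v₂ w₁ w₂`,
`Σ_{(m,n)∈ℤ²} e^{−2πQ(m+v₁,n+v₂)} e(w₁m+w₂n)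
  = Δ^{−1/2} Σ_{(k,l)∈ℤ²} e(v₁(k−w₁) + v₂(l−w₂)) e^{−2πQ̃(k−w₁,l−w₂)/Δ}`
(`f̂(ξ) = Δ^{−1/2}e^{−2πQ̃(ξ)/Δ}` for `f = e^{−2πQ}`). This is the generalized Jacobi inversion
formula `θ_A(z;X) = ((−iz)^r det A)^{−1/2} Σ_M e^{−πiA^{−1}[M]/z + 2πiX·M}`, `θ_A(z;X) = Σ_N e^{πizA[N+X]}`,
of the source for `r = 2` at `z = 2i` (`A = (α β/2; β/2 γ)`, `det A = Δ/4`, shift `X = v`), with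
an extra additive twist `w` (the same Poisson summation applied to `T ↦ e^{πizA[T]}e(w·T)`).
Proved here by completing the square in the second variable, the one-variable formula
`tsum_cexp_neg_sq_shift_twist` twice, and Fubini on `ℤ × ℤ`.
[cite: Gunning1962, §20 Generalized Jacobi Inversion Formula] -/
theorem tsum_cexp_neg_binaryQF_shift_twist {α β γ : ℝ} (hα : 0 < α) (hΔ : 0 < 4 * α * γ - β ^ 2)
    (v₁ v₂ w₁ w₂ : ℝ) :
    ∑' p : ℤ × ℤ, cexp (-(2 * π) * (α * ((p.1 : ℂ) + v₁) ^ 2 +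
        β * ((p.1 : ℂ) + v₁) * ((p.2 : ℂ) + v₂) + γ * ((p.2 : ℂ) + v₂) ^ 2) +
        2 * π * I * (w₁ * p.1 + w₂ * p.2)) =
      (Real.sqrt (4 * α * γ - β ^ 2) : ℂ)⁻¹ *
        ∑' p : ℤ × ℤ, cexp (2 * π * I * (v₁ * ((p.1 : ℂ) - w₁) + v₂ * ((p.2 : ℂ) - w₂)) -
          2 * π / (4 * α * γ - β ^ 2) * (γ * ((p.1 : ℂ) - w₁) ^ 2 -
            β * ((p.1 : ℂ) - w₁) * ((p.2 : ℂ) - w₂) + α * ((p.2 : ℂ) - w₂) ^ 2)) := by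
  have hγ : 0 < γ := by nlinarith [sq_nonneg β]
  have hγne : (γ : ℂ) ≠ 0 := Complex.ofReal_ne_zero.mpr hγ.ne'
  have hΔne : (4 * (α : ℂ) * γ - (β : ℂ) ^ 2) ≠ 0 := by exact_mod_cast hΔ.ne'
  have h2γ : 0 < 2 * γ := by positivity
  have hΔγ : 0 < (4 * α * γ - β ^ 2) / (2 * γ) := by positivity
  -- the three families: the summand `T`, the intermediate `U` (after the `n`-sum), the dual `V`
  set T : ℤ × ℤ → ℂ := fun p ↦ cexp (-(2 * π) * (α * ((p.1 : ℂ) + v₁) ^ 2 +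
      β * ((p.1 : ℂ) + v₁) * ((p.2 : ℂ) + v₂) + γ * ((p.2 : ℂ) + v₂) ^ 2) +
      2 * π * I * (w₁ * p.1 + w₂ * p.2)) with hT
  set A : ℤ → ℂ := fun m ↦
    -(π * (((4 * α * γ - β ^ 2) / (2 * γ) : ℝ) : ℂ)) * ((m : ℂ) + v₁) ^ 2 + 2 * π * I * w₁ * m with hA
  set U : ℤ → ℤ → ℂ := fun m l ↦ cexp (A m) * ((Real.sqrt (2 * γ) : ℂ)⁻¹ *
      cexp (2 * π * I * ((v₂ + β * (m + v₁) / (2 * γ) : ℝ) : ℂ) * ((l : ℂ) - w₂) -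
        π / ((2 * γ : ℝ) : ℂ) * ((l : ℂ) - w₂) ^ 2)) with hU
  set V : ℤ × ℤ → ℂ := fun p ↦ cexp (2 * π * I * (v₁ * ((p.1 : ℂ) - w₁) + v₂ * ((p.2 : ℂ) - w₂)) -
      2 * π / (4 * α * γ - β ^ 2) * (γ * ((p.1 : ℂ) - w₁) ^ 2 -
        β * ((p.1 : ℂ) - w₁) * ((p.2 : ℂ) - w₂) + α * ((p.2 : ℂ) - w₂) ^ 2)) with hV
  -- Step 1: completing the square in `n`
  have step1 : ∀ m n : ℤ, T (m, n) = cexp (A m) *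
      cexp (-(π * ((2 * γ : ℝ) : ℂ)) * ((n : ℂ) + ((v₂ + β * (m + v₁) / (2 * γ) : ℝ) : ℂ)) ^ 2 +
        2 * π * I * (w₂ : ℂ) * n) := by
    intro m n
    simp only [hT, hA, ← Complex.exp_add]
    congr 1
    push_cast
    field_simp
    ring
  -- Step 2: the inner sum over `n` (one-variable Poisson, modulus `2γ`)
  have step2 : ∀ m : ℤ, ∑' n : ℤ, T (m, n) = ∑' l : ℤ, U m l := by
    intro m
    simp_rw [step1 m]
    rw [tsum_mul_left, tsum_cexp_neg_sq_shift_twist h2γ _ w₂, ← tsum_mul_left, ← tsum_mul_left]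
  -- Step 3: regrouping `U m l` as (constant in `m`) × (one-variable summand in `m`)
  have step3 : ∀ m l : ℤ, U m l = (Real.sqrt (2 * γ) : ℂ)⁻¹ *
      cexp (2 * π * I * ((l : ℂ) - w₂) * (v₂ + β * v₁ / (2 * γ)) -
        π / ((2 * γ : ℝ) : ℂ) * ((l : ℂ) - w₂) ^ 2) *
      cexp (-(π * (((4 * α * γ - β ^ 2) / (2 * γ) : ℝ) : ℂ)) * ((m : ℂ) + v₁) ^ 2 +
        2 * π * I * ((w₁ + (l - w₂) * β / (2 * γ) : ℝ) : ℂ) * m) := by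
    intro m l
    simp only [hU, hA]
    rw [mul_left_comm, ← Complex.exp_add]
    conv_rhs => rw [mul_assoc, ← Complex.exp_add]
    congr 2
    push_cast
    field_simp
    ring
  -- Step 4: the sum over `m` for fixed `l` (one-variable Poisson, modulus `Δ/2γ`)
  have hsqrt : (Real.sqrt (2 * γ) : ℂ)⁻¹ * (Real.sqrt ((4 * α * γ - β ^ 2) / (2 * γ)) : ℂ)⁻¹ =
      (Real.sqrt (4 * α * γ - β ^ 2) : ℂ)⁻¹ := by
    have e : 2 * γ * ((4 * α * γ - β ^ 2) / (2 * γ)) = (4 * α * γ - β ^ 2) := by field_simp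
    rw [← mul_inv, ← Complex.ofReal_mul, ← Real.sqrt_mul h2γ.le, e]
  have step4 : ∀ l : ℤ, ∑' m : ℤ, U m l = (Real.sqrt (4 * α * γ - β ^ 2) : ℂ)⁻¹ * ∑' k : ℤ, V (k, l) := by
    intro l
    simp_rw [step3 _ l]
    rw [tsum_mul_left, tsum_cexp_neg_sq_shift_twist hΔγ v₁ _, mul_assoc, mul_left_comm (cexp _),
      ← mul_assoc, hsqrt, ← tsum_mul_left]
    congr 1
    refine tsum_congr fun k ↦ ?_
    rw [← Complex.exp_add]
    simp only [hV]
    congr 1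
    push_cast
    set D : ℂ := 4 * (α : ℂ) * γ - (β : ℂ) ^ 2 with hD
    field_simp
    rw [hD]
    ring
  -- summability of the three families
  have hTs : Summable T := by
    have hg := summable_exp_neg_binaryQF (α := 2 * π * α) (β := 2 * π * β) (γ := 2 * π * γ)
      (by positivity) ?_ v₁ v₂
    · refine Summable.of_norm_bounded hg fun p ↦ le_of_eq ?_
      simp only [hT]
      rw [show -(2 * π) * (α * ((p.1 : ℂ) + v₁) ^ 2 + β * ((p.1 : ℂ) + v₁) * ((p.2 : ℂ) + v₂) +
          γ * ((p.2 : ℂ) + v₂) ^ 2) + 2 * π * I * (w₁ * p.1 + w₂ * p.2) =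
          ((-(2 * π * α * ((p.1 : ℝ) + v₁) ^ 2 + 2 * π * β * ((p.1 : ℝ) + v₁) * ((p.2 : ℝ) + v₂) +
            2 * π * γ * ((p.2 : ℝ) + v₂) ^ 2) : ℝ) : ℂ) +
            ((2 * π * (w₁ * p.1 + w₂ * p.2) : ℝ) : ℂ) * I by
          push_cast; ring, norm_cexp_ofReal_add_mul_I]
    · have e : 4 * (2 * π * α) * (2 * π * γ) - (2 * π * β) ^ 2 = 4 * π ^ 2 * (4 * α * γ - β ^ 2) := by ring
      rw [e]; positivity
  have hUs : Summable (Function.uncurry U) := by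
    have h1 := summable_exp_neg_mul_sq_add_int (c := π * ((4 * α * γ - β ^ 2) / (2 * γ))) (by positivity) v₁
    have h2 := summable_exp_neg_mul_sq_add_int (c := π / (2 * γ)) (by positivity) (-w₂)
    have hg := (h1.mul_of_nonneg h2 (fun _ ↦ (Real.exp_pos _).le)
      (fun _ ↦ (Real.exp_pos _).le)).mul_left (Real.sqrt (2 * γ))⁻¹
    refine Summable.of_norm_bounded hg fun p ↦ le_of_eq ?_
    rcases p with ⟨m, l⟩
    simp only [Function.uncurry_apply_pair, hU, hA]
    rw [norm_mul, norm_mul, norm_inv, Complex.norm_real, Real.norm_of_nonneg (Real.sqrt_nonneg _),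
      show -(π * (((4 * α * γ - β ^ 2) / (2 * γ) : ℝ) : ℂ)) * ((m : ℂ) + v₁) ^ 2 + 2 * π * I * w₁ * m =
        ((-(π * ((4 * α * γ - β ^ 2) / (2 * γ))) * ((m : ℝ) + v₁) ^ 2 : ℝ) : ℂ) +
          ((2 * π * w₁ * m : ℝ) : ℂ) * I by
        push_cast; ring, norm_cexp_ofReal_add_mul_I,
      show 2 * π * I * ((v₂ + β * (m + v₁) / (2 * γ) : ℝ) : ℂ) * ((l : ℂ) - w₂) -
          π / ((2 * γ : ℝ) : ℂ) * ((l : ℂ) - w₂) ^ 2 =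
        ((-(π / (2 * γ)) * ((l : ℝ) + -w₂) ^ 2 : ℝ) : ℂ) +
          ((2 * π * (v₂ + β * (m + v₁) / (2 * γ)) * (l - w₂) : ℝ) : ℂ) * I by
        push_cast; ring, norm_cexp_ofReal_add_mul_I]
    ring
  have hVs : Summable V := by
    have hg := summable_exp_neg_binaryQF (α := 2 * π * γ / (4 * α * γ - β ^ 2)) (β := -(2 * π * β / (4 * α * γ - β ^ 2)))
      (γ := 2 * π * α / (4 * α * γ - β ^ 2)) (by positivity) ?_ (-w₁) (-w₂)
    · refine Summable.of_norm_bounded hg fun p ↦ le_of_eq ?_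
      simp only [hV]
      rw [show 2 * π * I * (v₁ * ((p.1 : ℂ) - w₁) + v₂ * ((p.2 : ℂ) - w₂)) -
          2 * π / (4 * α * γ - β ^ 2) * (γ * ((p.1 : ℂ) - w₁) ^ 2 -
            β * ((p.1 : ℂ) - w₁) * ((p.2 : ℂ) - w₂) + α * ((p.2 : ℂ) - w₂) ^ 2) =
          ((-(2 * π * γ / (4 * α * γ - β ^ 2) * ((p.1 : ℝ) + -w₁) ^ 2 +
            -(2 * π * β / (4 * α * γ - β ^ 2)) * ((p.1 : ℝ) + -w₁) * ((p.2 : ℝ) + -w₂) +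
            2 * π * α / (4 * α * γ - β ^ 2) * ((p.2 : ℝ) + -w₂) ^ 2) : ℝ) : ℂ) +
            ((2 * π * (v₁ * (p.1 - w₁) + v₂ * (p.2 - w₂)) : ℝ) : ℂ) * I by
          push_cast; ring, norm_cexp_ofReal_add_mul_I]
    · have e : 4 * (2 * π * γ / (4 * α * γ - β ^ 2)) * (2 * π * α / (4 * α * γ - β ^ 2)) - (-(2 * π * β / (4 * α * γ - β ^ 2))) ^ 2 =
          4 * π ^ 2 / (4 * α * γ - β ^ 2) := by
        field_simp; ring
      rw [e]; positivity
  have hVs' : Summable (Function.uncurry fun k l ↦ V (k, l)) := by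
    simpa only [Function.uncurry_def] using hVs
  -- assembling
  calc ∑' p : ℤ × ℤ, T p = ∑' m : ℤ, ∑' n : ℤ, T (m, n) := hTs.tsum_prod
    _ = ∑' m : ℤ, ∑' l : ℤ, U m l := tsum_congr step2
    _ = ∑' l : ℤ, ∑' m : ℤ, U m l := hUs.tsum_comm.symm
    _ = ∑' l : ℤ, (Real.sqrt (4 * α * γ - β ^ 2) : ℂ)⁻¹ * ∑' k : ℤ, V (k, l) := tsum_congr step4
    _ = (Real.sqrt (4 * α * γ - β ^ 2) : ℂ)⁻¹ * ∑' l : ℤ, ∑' k : ℤ, V (k, l) := tsum_mul_left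
    _ = (Real.sqrt (4 * α * γ - β ^ 2) : ℂ)⁻¹ * ∑' k : ℤ, ∑' l : ℤ, V (k, l) := by rw [hVs'.tsum_comm]
    _ = (Real.sqrt (4 * α * γ - β ^ 2) : ℂ)⁻¹ * ∑' p : ℤ × ℤ, V p := by rw [hVs.tsum_prod]


/-! ## Integral forms: the congruent theta series -/

/-- **The transformation formula for the congruent theta series of an integral positive-definite
binary quadratic form.** For `Q(m,n) = am² + bmn + cn²` with `a, b, c ∈ ℤ`, `a > 0`,
`D = b² − 4ac < 0`, a modulus `c₀ ≥ 1`, residues `μ, ν ∈ ℤ` and `y > 0`: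
`Σ_{(m,n)∈ℤ²} e^{−2πy·Q(c₀m+μ, c₀n+ν)}
  = (c₀²y√|D|)⁻¹ Σ_{(k,l)∈ℤ²} e((μk+νl)/c₀) e^{−2π(ck² − bkl + al²)/(c₀²y|D|)}`,
i.e. the theta series of `Q` over the congruence class `(m,n) ≡ (μ,ν) (mod c₀)` at `z = iy` equals
a Gauss-sum-ready dual series in the adjoint form `Q̃(k,l) = ck² − bkl + al²` at height
`1/(c₀²|D|y)` (`tsum_cexp_neg_binaryQF_shift_twist` with `α,β,γ = yc₀²·(a,b,c)`, shift
`(μ/c₀, ν/c₀)`, no twist; `𝐞 = Real.fourierChar`). In the source: the inversion formula of §20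
for `θ(c²ζ; N/c + X/(cq))`, the building block of the congruence decomposition
`θ(ζ + a/c; X/q) = Σ_{N mod c} e((a/c)A[N + X/q]) θ(c²ζ; N/c + X/(cq))` (§22 Lemma 4).
[cite: Gunning1962, §20 Generalized Jacobi Inversion Formula; §22 Lemma 4] -/
theorem tsum_exp_neg_congr_binaryQF (a b c : ℤ) (ha : 0 < a) (hD : b ^ 2 - 4 * a * c < 0)
    (c₀ : ℕ) (hc₀ : 0 < c₀) (μ ν : ℤ) {y : ℝ} (hy : 0 < y) :
    ∑' p : ℤ × ℤ,
        (Real.exp (-(2 * π * y) *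
          ((a * (c₀ * p.1 + μ) ^ 2 + b * (c₀ * p.1 + μ) * (c₀ * p.2 + ν) +
            c * (c₀ * p.2 + ν) ^ 2 : ℤ) : ℝ)) : ℂ) =
      (((c₀ : ℝ) ^ 2 * y * Real.sqrt ((4 * a * c - b ^ 2 : ℤ) : ℝ))⁻¹ : ℝ) *
        ∑' p : ℤ × ℤ, (𝐞 (((μ * p.1 + ν * p.2 : ℤ) : ℝ) / c₀) : ℂ) *
          (Real.exp (-(2 * π) / ((c₀ : ℝ) ^ 2 * y * ((4 * a * c - b ^ 2 : ℤ) : ℝ)) *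
            ((c * p.1 ^ 2 - b * p.1 * p.2 + a * p.2 ^ 2 : ℤ) : ℝ)) : ℂ) := by
  have hDpos : (0 : ℝ) < ((4 * a * c - b ^ 2 : ℤ) : ℝ) := by
    exact_mod_cast (by linarith : (0 : ℤ) < 4 * a * c - b ^ 2)
  have haR : (0 : ℝ) < (a : ℝ) := by exact_mod_cast ha
  have hc₀R : (0 : ℝ) < (c₀ : ℝ) := by exact_mod_cast hc₀
  have hc₀ne : (c₀ : ℂ) ≠ 0 := by exact_mod_cast hc₀.ne'
  have hyne : (y : ℂ) ≠ 0 := Complex.ofReal_ne_zero.mpr hy.ne'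
  have hDne : ((4 * a * c - b ^ 2 : ℤ) : ℂ) ≠ 0 := by exact_mod_cast (by linarith : (4 * a * c - b ^ 2 : ℤ) ≠ 0)
  have hK : 4 * (y * c₀ ^ 2 * a) * (y * c₀ ^ 2 * c) - (y * c₀ ^ 2 * b) ^ 2 =
      ((c₀ : ℝ) ^ 2 * y) ^ 2 * ((4 * a * c - b ^ 2 : ℤ) : ℝ) := by push_cast; ring
  have hΔ : 0 < 4 * (y * c₀ ^ 2 * a) * (y * c₀ ^ 2 * c) - (y * c₀ ^ 2 * b) ^ 2 := by
    rw [hK]; positivity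
  have h := tsum_cexp_neg_binaryQF_shift_twist (α := y * c₀ ^ 2 * a) (β := y * c₀ ^ 2 * b)
    (γ := y * c₀ ^ 2 * c) (by positivity) hΔ (μ / c₀) (ν / c₀) 0 0
  have hsqrt : Real.sqrt (4 * (y * c₀ ^ 2 * a) * (y * c₀ ^ 2 * c) - (y * c₀ ^ 2 * b) ^ 2) =
      (c₀ : ℝ) ^ 2 * y * Real.sqrt ((4 * a * c - b ^ 2 : ℤ) : ℝ) := by
    rw [hK, Real.sqrt_mul (sq_nonneg _), Real.sqrt_sq (by positivity)]
  calc ∑' p : ℤ × ℤ, (Real.exp (-(2 * π * y) *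
          ((a * (c₀ * p.1 + μ) ^ 2 + b * (c₀ * p.1 + μ) * (c₀ * p.2 + ν) +
            c * (c₀ * p.2 + ν) ^ 2 : ℤ) : ℝ)) : ℂ)
      = ∑' p : ℤ × ℤ, cexp (-(2 * π) * ((y * c₀ ^ 2 * a : ℝ) * ((p.1 : ℂ) + (μ / c₀ : ℝ)) ^ 2 +
          (y * c₀ ^ 2 * b : ℝ) * ((p.1 : ℂ) + (μ / c₀ : ℝ)) * ((p.2 : ℂ) + (ν / c₀ : ℝ)) +
          (y * c₀ ^ 2 * c : ℝ) * ((p.2 : ℂ) + (ν / c₀ : ℝ)) ^ 2) +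
          2 * π * I * ((0 : ℝ) * p.1 + (0 : ℝ) * p.2)) := by
        refine tsum_congr fun p ↦ ?_
        rw [Complex.ofReal_exp]
        congr 1
        push_cast
        field_simp
        ring
    _ = _ := h
    _ = _ := by
        rw [hsqrt, ← Complex.ofReal_inv]
        congr 1
        refine tsum_congr fun p ↦ ?_
        rw [Real.fourierChar_apply, Complex.ofReal_exp, ← Complex.exp_add]
        congr 1
        push_cast
        field_simp
        ring

end Literature.NumberTheory.Automorphic

end
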